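import Summits.NavierStokesRegularity.NavierStokesRegularity.Theses.FilamentSkeletonRss
import HarnessLib.Audit

/-!
# Line `mirror-point-negation` — a second NEGATION skeleton for the crux `FilamentSkeletonRss.SkeletonEquilibrium`
(crux item stmt-NavierStokesRegularity-15400; strategist `planner-cstrat-stmt-NavierStokesRegularity-15400-s2-0`,
2026-08-17; card `Lines/mirror-point-negation.md`, census `STRATEGY-CENSUS.md` (s2 section), compute evidence
`offset-waist gyration scan` (kit j024957) and `compute/linear_axis.py`.)

The crux is FIXED (by name). This file RE-CUTS strategist s1's negation line `kelvin-sonic-negation`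
(`Lines/kelvin_sonic_negation.lean`), whose one XL stub `stub_kelvinSonicVerticality` bundled three different
pieces of mathematics, into stubs that separate them, and closes the two gaps found in s1's mechanism
(offset waists and far/adiabatic waists were never examined: s1's scan F1 covered only launches FROM THE ORIGIN):

* `stub_lengthRegular`            — s1's STUB 0, shared VERBATIM (same name, same statement): no dense coils.   [L, conj.-mild]
* `stub_outerShadowing`           — TWO-SCALE REDUCTION: for Γ large every length-regular witness filament is shadowed,
  in the common outer unit `ℓ = √(Γ log Γ / 2)` (Ξ = ℓ·Y), by a unit-speed solution of the OUTER ODE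
  `Y″ = (4π/γ_k) • Y′ × (½Y − α e₃×Y)` (local induction against the frame drift): tangents matched on the inner
  ball, C¹-shadowing on an outer shell.                                                                        [XL−]
* `stub_rippleFree`               — THE MICROLOCAL CORE (Kelvin-sonic obstruction proper): for Γ large every length-regular
  witness with supercritical stagnation points carries NO free Kelvin ripple on the outer shell — the RIPPLE
  FUNCTIONAL q = ‖Y′ − c b̂ − (c/β)(b̂ × A Y′)/‖A Y‖²‖·‖Y‖ (gyration of the tangent about the drift direction
  b̂ = A Y/‖A Y‖ with the first-order slaved part removed) is ≤ ε there — and every stagnation point lies inside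
  the outer unit ball. Mechanism: saturating Rosenhead dispersion ⇒ sonic folds at |Ξ| ≈ 0.54·Γγ/4π, 0.78·Γγ/4π ⇒
  trapped characteristic chain ending in a radial sink AT the stagnation point whose exponent is
  Re μ = (3/2 − w′)/(2w′) < 0 under (SC) for BOTH polarisations (s2 fast-rotation averaging lemma), so mere
  BOUNDEDNESS of the curve kills all arriving content; far waists are maximally rippled (mirror-point law).     [XL]
* `stub_rippleLipschitz`          — the ripple functional is Lipschitz in (Y, Y′) on {R₁/2 ≤ ‖Y‖ ≤ 2R₃} × {‖Y′‖ ≤ 1}.   [M, provable now]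
* `stub_mirrorPointSelection`     — THE NEW TYPED OBSTRUCTION (pure ODE; lens: negation): a solution of the outer ODE whose
  ripple functional is ≤ ε₀ on the shell R₁ ≤ ‖Y‖ ≤ R₃ is θ-VERTICAL wherever it is within outer distance 2 of the
  origin. Content: (i) a stagnation point of the outer dynamics is a MIRROR POINT (Y′ ⊥ A Y: all of the unit speed
  is gyration), so a waist at outer distance |Y₀| radiates ripple C₀ ≈ |Y₀| on both ends (anti-mirror law
  v⊥|Y| ≈ const; scan: C₀(|Y₀| = 4, 8) = 3.79–4.01, 8.00); (ii) the axis datum is a NONDEGENERATE zero of the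
  gyration map — the linearisation at the axis is the Weber equation ζ″ + (is/2)ζ′ − (α + i/2)ζ = 0, whose
  ripple-free-at-+∞ solution is the parabolic-cylinder function U(2iα − 3/2, x e^{−iπ/4}) and acquires at −∞ a
  ripple ∝ 1/Γ(·) ≠ 0 for every real α ≠ 0 (numerically |b_tilt(α)|/2 = 1.412, 0.978, 32.7 at α = −1, −½, +1,
  matching the nonlinear C₀/θ to 4 digits; chirality ratio e^{π|α|}); (iii) no other zero on the 4-parameter family
  of waist data (kit scan j024957 over (r₀, z₀, ψ, α) + Nelder–Mead refinements).                              [L]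
* `stub_nearVerticalSubcritical`  — s1's STUB 2, shared VERBATIM: near-vertical length-regular configurations are
  subcritical, `w′(τ*) ≤ ½ + C(θ + 1/R)`.                                                                        [L, provable now]

Composition `not_SkeletonEquilibrium_of` (sorry-free, below): data ⇒ C₀ (length regularity) ⇒ C (subcriticality
constant) ⇒ θ = 1/(4(C+1)), R = 4(C+1) ⇒ (ε₀, R₁, R₃) from the selection stub at tolerance θ/2 ⇒ Lipschitz constant
C_q on the doubled shell ⇒ ε = min(θ/2, R₁/2, ε₀/(2C_q+2)) ⇒ Γ₁ (shadowing), Γ₂ (ripple-free) ⇒ evaluate the crux at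
Γ₀ = max(Γ₁, Γ₂, 2): for every filament k, the shadowing solution Yo_k is ripple ≤ ε + 2C_qε ≤ ε₀ on the shell
(reverse shadowing + ripple-free + Lipschitz), hence θ/2-vertical on the outer 2-ball (selection), hence every strand
of Ξ_k within R√Γ of the stagnation point Ξ_j(τ*) (which lies in the outer unit ball) is θ-vertical (tangent
matching + ‖(a − b) × e₃‖ ≤ ‖a − b‖), hence `w_j′(τ*) ≤ ½ + C(θ + 1/R) ≤ 1 < 3/2 + δ`: contradiction with (SC).

## Disproof used
`Cruxes/SkeletonEquilibrium/Disproof.lean` (cdisprove c1): (a) (SC) is THE load-bearing clause — attacked head-on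
(`w′ ≤ 1`); (b) strain identity — inside `stub_nearVerticalSubcritical` and at the sink (tr B = 3/2 − w′);
(c1)–(c3) rigid classes — this line is their asymptotic completion ("every witness is the axis at leading order");
(c4) oddness / σ_z-reversibility of origin launches — used in the scan's bookkeeping (both ends of an origin launch
have the same C₀); (e2) tail law — consistent. No `_false_without_` theorem exists; no landed Negative lemma refutes a
stub (they concern exact lines / planes / parallel arrays; the stubs are perturbative or pure-ODE statements).
-/

noncomputable section

open Set MeasureTheory Filter Topology
open Literature.Analysis.FluidPDE
open scoped RealInnerProductSpace InnerProductSpace BigOperators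

namespace Summit.NavierStokesRegularity.NavierStokesRegularity.Cruxes.SkeletonEquilibrium.MirrorPointNegation

set_option linter.unusedVariables false
set_option linter.dupNamespace false

/-- **STUB 0 (`stub_lengthRegular`; size L; conjectural, mild) — SHARED VERBATIM with s1's line
`kelvin-sonic-negation` (same name, same statement; one landing serves both lines).** Relative equilibria of the
regularised Biot–Savart law in the rotating Leray frame satisfying the configuration clauses at `Γ ≥ 1` are
LENGTH-REGULAR at scales `≥ √Γ`: arclength inside any ball of radius `D ≥ √Γ` is `≤ C₀ D`. Why plausibly true /
why it might fail: see s1's docstring; s2 adds (census §Negation N-d): an end that stays subsonic for ever needs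
induction ≳ |Ξ|/4 along it, i.e. strand density ∝ |Ξ| nearby, and such densifying solenoids violate the crux's
absolute-integrability clause — so the worst coils are already excluded by the clauses; hairpins are not. [conjecture] -/
theorem stub_lengthRegular :
    ∀ (N : ℕ) (γ : Fin N → ℝ) (α ρ K : ℝ), α ≠ 0 → 0 < ρ →
      ∃ C₀ : ℝ, 0 < C₀ ∧ ∀ Γ : ℝ, 1 ≤ Γ →
        ∀ (Ξ : Fin N → ℝ → EuclideanSpace ℝ (Fin 3)) (w : Fin N → ℝ → ℝ),
          (∀ j, ContDiff ℝ 2 (Ξ j) ∧ Function.Injective (Ξ j) ∧ Differentiable ℝ (w j) ∧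
              (∀ τ, ‖deriv (Ξ j) τ‖ = 1) ∧ (∀ τ, ‖iteratedDeriv 2 (Ξ j) τ‖ * Real.sqrt Γ ≤ K) ∧
              Tendsto (fun τ => ‖Ξ j τ‖) atTop atTop ∧ Tendsto (fun τ => ‖Ξ j τ‖) atBot atTop) →
          (∀ j k, j ≠ k → ∀ τ σ, ρ * Real.sqrt Γ ≤ ‖Ξ j τ - Ξ k σ‖) →
          (∀ j (x : EuclideanSpace ℝ (Fin 3)), Integrable (fun σ : ℝ =>
              ((‖x - Ξ j σ‖ ^ 2 + 1) ^ (3 / 2 : ℝ))⁻¹ • cross (deriv (Ξ j) σ) (x - Ξ j σ))) →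
          (∀ j τ, (∑ k : Fin N, (Γ * γ k / (4 * Real.pi)) • ∫ σ : ℝ,
                ((‖Ξ j τ - Ξ k σ‖ ^ 2 + 1) ^ (3 / 2 : ℝ))⁻¹ • cross (deriv (Ξ k) σ) (Ξ j τ - Ξ k σ))
              + (1 / 2 : ℝ) • Ξ j τ - α • cross (EuclideanSpace.single (2 : Fin 3) (1 : ℝ)) (Ξ j τ)
              = w j τ • deriv (Ξ j) τ) →
          ∀ (k : Fin N) (x : EuclideanSpace ℝ (Fin 3)) (D : ℝ), Real.sqrt Γ ≤ D →
            volume {τ : ℝ | ‖Ξ k τ - x‖ ≤ D} ≤ ENNReal.ofReal (C₀ * D) := by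
  sorry

/-- **STUB 1 (`stub_outerShadowing`; size XL−; the two-scale reduction).** Fix the data, a length-regularity
constant `C₀`, a tolerance `ε`, shell radii `0 < R₁ ≤ R₃` and an inner radius parameter `R ≥ 0`. For all large `Γ`,
every filament `k` of a `C₀`-length-regular configuration satisfying the clauses is SHADOWED, in the common outer
unit `ℓ = √(Γ log Γ / 2)` (so `Ξ = ℓ • Y`; `ℓ = √Γ · √(log(1/e))`, `e = Γ^{-1/2}` the core in waist units), by a
unit-speed `C²` solution `Yo` of the OUTER ODE `Yo″ = (4π/γ_k) • Yo′ × (½ Yo − α e₃ × Yo)` (local induction with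
coefficient `(γ_k/4π) log(1/e)` against the frame drift; Da Rios/LIA + anti-mirror card), in the sense the
composition needs: (a) every point of `Ξ_k` in the ball `‖Ξ‖ ≤ ℓ + R√Γ` has its unit tangent within `ε` of the
tangent of `Yo` at some point of the outer 2-ball; (b) every point of `Yo` in the shell `R₁ ≤ ‖Yo s‖ ≤ R₃` is
within `ε` in position (outer units) and tangent of some point of `Ξ_k`. Why plausibly true: inside the bending
scale the local induction is `log(1/e)`-stiff, so on outer-bounded windows the `e → 0` limit of the tangency
system is REGULAR in the outer variables (lead memo c3 blueprint; landed e-uniform LIA bricks p137771, p137835,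
p136576, p136731) and mutual induction is `O(1/log Γ)` there (separation `ρ√Γ`, length-regularity for the far
strands). Why it might fail: a length-regular but WILD witness (a levitating hairpin: two antiparallel strands of
one filament at waist distance `4g/|X|`, self-propelling against the drift) is not shadowed by one ODE solution —
the stub asserts such equilibria do not occur at large `Γ`. [conjecture] -/
theorem stub_outerShadowing :
    ∀ (N : ℕ) (γ : Fin N → ℝ) (α ρ K C₀ : ℝ), α ≠ 0 → 0 < ρ → 0 < C₀ → (∀ j, γ j ≠ 0) →
      ∀ ε : ℝ, 0 < ε → ∀ R₁ R₃ R : ℝ, 0 < R₁ → R₁ ≤ R₃ → 0 ≤ R →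
      ∃ Γ₁ : ℝ, ∀ Γ : ℝ, Γ₁ ≤ Γ → 1 ≤ Γ →
        ∀ (Ξ : Fin N → ℝ → EuclideanSpace ℝ (Fin 3)) (w : Fin N → ℝ → ℝ),
          (∀ j, ContDiff ℝ 2 (Ξ j) ∧ Function.Injective (Ξ j) ∧ Differentiable ℝ (w j) ∧
              (∀ τ, ‖deriv (Ξ j) τ‖ = 1) ∧ (∀ τ, ‖iteratedDeriv 2 (Ξ j) τ‖ * Real.sqrt Γ ≤ K) ∧
              Tendsto (fun τ => ‖Ξ j τ‖) atTop atTop ∧ Tendsto (fun τ => ‖Ξ j τ‖) atBot atTop) →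
          (∀ j k, j ≠ k → ∀ τ σ, ρ * Real.sqrt Γ ≤ ‖Ξ j τ - Ξ k σ‖) →
          (∀ j (x : EuclideanSpace ℝ (Fin 3)), Integrable (fun σ : ℝ =>
              ((‖x - Ξ j σ‖ ^ 2 + 1) ^ (3 / 2 : ℝ))⁻¹ • cross (deriv (Ξ j) σ) (x - Ξ j σ))) →
          (∀ j τ, (∑ k : Fin N, (Γ * γ k / (4 * Real.pi)) • ∫ σ : ℝ,
                ((‖Ξ j τ - Ξ k σ‖ ^ 2 + 1) ^ (3 / 2 : ℝ))⁻¹ • cross (deriv (Ξ k) σ) (Ξ j τ - Ξ k σ))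
              + (1 / 2 : ℝ) • Ξ j τ - α • cross (EuclideanSpace.single (2 : Fin 3) (1 : ℝ)) (Ξ j τ)
              = w j τ • deriv (Ξ j) τ) →
          (∀ (k : Fin N) (x : EuclideanSpace ℝ (Fin 3)) (D : ℝ), Real.sqrt Γ ≤ D →
              volume {τ : ℝ | ‖Ξ k τ - x‖ ≤ D} ≤ ENNReal.ofReal (C₀ * D)) →
          ∀ k : Fin N, ∃ Yo : ℝ → EuclideanSpace ℝ (Fin 3),
            ContDiff ℝ 2 Yo ∧ (∀ s, ‖deriv Yo s‖ = 1) ∧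
            (∀ s, iteratedDeriv 2 Yo s =
                (4 * Real.pi / γ k) • cross (deriv Yo s) ((1 / 2 : ℝ) • Yo s - α • cross (EuclideanSpace.single (2 : Fin 3) (1 : ℝ)) (Yo s))) ∧
            (∀ τ, ‖Ξ k τ‖ ≤ Real.sqrt (Γ * Real.log Γ / 2) + R * Real.sqrt Γ →
                ∃ s, ‖Yo s‖ ≤ 2 ∧ ‖deriv (Ξ k) τ - deriv Yo s‖ ≤ ε) ∧
            (∀ s, R₁ ≤ ‖Yo s‖ → ‖Yo s‖ ≤ R₃ →
                ∃ τ, ‖(Real.sqrt (Γ * Real.log Γ / 2))⁻¹ • Ξ k τ - Yo s‖ ≤ ε ∧ ‖deriv (Ξ k) τ - deriv Yo s‖ ≤ ε) := by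
  sorry

/-- **STUB 2 (`stub_rippleFree`; size XL; THE microlocal core — the Kelvin-sonic obstruction proper).**
Fix the data (with the supercriticality margin `δ > 0`), a length-regularity constant `C₀`, a tolerance `ε` and
shell radii. For all large `Γ`, every `C₀`-length-regular configuration satisfying the clauses AND the crux's
stagnation clause (unique zero `τ*` of `w_j`, `w_j′(τ*) ≥ 3/2 + δ` on every filament) has (i) RIPPLE FUNCTIONAL
`≤ ε` at every point of every filament in the outer shell `R₁ ≤ ‖Y‖ ≤ R₃` (`Y = ℓ⁻¹ Ξ`, `ℓ = √(Γ log Γ/2)`), where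
the ripple functional of `(Y, T)` with parameter `β = 4π/γ_k` is `‖T − c b − (c/β/‖B‖²) • b × Bt‖ · ‖Y‖`,
`B = ½Y − α e₃×Y`, `b = B/‖B‖`, `Bt = ½T − α e₃×T`, `c = ⟪T, b⟫` — the gyration of the tangent about the drift
direction with the first-order slaved part removed, whose far-field limit is the free-gyration amplitude `C₀` of the
end (= branch-a Kelvin content); and (ii) every stagnation point inside the outer unit ball, `‖Ξ_j(τ*)‖ ≤ ℓ`.
Mechanism (s1 census §Negation, lead memo c3 §1, s2 census): the exact Rosenhead multiplier
`m(κ) = 2 − 2κK₁(κ) − 2κ²K₀(κ)` saturates, so along every proper end the slip outruns the bending waves (folds at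
`|V| = 0.2688 g/e`, `0.3900 g/e`); the steady characteristic chain a → fold → b → crossing → fold → B↓ ends in a
radial sink at the stagnation point where, by fast-rotation averaging, arriving content behaves like
`|t − t*|^μ` with `Re μ = (3/2 − w′)/(2w′) < 0` under (SC) in both polarisations — unbounded, so a continuous witness
carries none, hence (backwards along the chain, total reflection at both folds by temperedness) no branch-a
content: ripple-free ends. (ii) is the mirror-point law: a waist at outer distance `|Y₀| ≥ 1` is launched
perpendicular to a drift of size `≥ ½|Y₀|` and radiates ripple `C₀ ≈ |Y₀|` (scan: 3.79 at 4, 8.00 at 8).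
Why it might fail: the microlocal argument is formal — uniform-in-`e` propagation / turning-point / radial-point
estimates for the NONLOCAL operator `J g m_e(D) − V∂_t + B` linearised about an unknown witness, and the nonlinear
reduction, are unproved (shape: Duistermaat–Hörmander + Melrose/Vasy radial estimates, doi:10.1007/s00222-012-0446-8;
hydraulic analogue: double reflection of capillary–gravity waves on an accelerating counter-current,
Trulsen–Mei doi:10.1017/s0022112093003404). [conjecture] -/
theorem stub_rippleFree :
    ∀ (N : ℕ) (γ : Fin N → ℝ) (α δ ρ K C₀ : ℝ), α ≠ 0 → 0 < δ → 0 < ρ → 0 < C₀ → (∀ j, γ j ≠ 0) →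
      ∀ ε : ℝ, 0 < ε → ∀ R₁ R₃ : ℝ, 0 < R₁ → R₁ ≤ R₃ →
      ∃ Γ₂ : ℝ, ∀ Γ : ℝ, Γ₂ ≤ Γ → 1 ≤ Γ →
        ∀ (Ξ : Fin N → ℝ → EuclideanSpace ℝ (Fin 3)) (w : Fin N → ℝ → ℝ),
          (∀ j, ContDiff ℝ 2 (Ξ j) ∧ Function.Injective (Ξ j) ∧ Differentiable ℝ (w j) ∧
              (∀ τ, ‖deriv (Ξ j) τ‖ = 1) ∧ (∀ τ, ‖iteratedDeriv 2 (Ξ j) τ‖ * Real.sqrt Γ ≤ K) ∧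
              Tendsto (fun τ => ‖Ξ j τ‖) atTop atTop ∧ Tendsto (fun τ => ‖Ξ j τ‖) atBot atTop) →
          (∀ j k, j ≠ k → ∀ τ σ, ρ * Real.sqrt Γ ≤ ‖Ξ j τ - Ξ k σ‖) →
          (∀ j (x : EuclideanSpace ℝ (Fin 3)), Integrable (fun σ : ℝ =>
              ((‖x - Ξ j σ‖ ^ 2 + 1) ^ (3 / 2 : ℝ))⁻¹ • cross (deriv (Ξ j) σ) (x - Ξ j σ))) →
          (∀ j τ, (∑ k : Fin N, (Γ * γ k / (4 * Real.pi)) • ∫ σ : ℝ,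
                ((‖Ξ j τ - Ξ k σ‖ ^ 2 + 1) ^ (3 / 2 : ℝ))⁻¹ • cross (deriv (Ξ k) σ) (Ξ j τ - Ξ k σ))
              + (1 / 2 : ℝ) • Ξ j τ - α • cross (EuclideanSpace.single (2 : Fin 3) (1 : ℝ)) (Ξ j τ)
              = w j τ • deriv (Ξ j) τ) →
          (∀ (k : Fin N) (x : EuclideanSpace ℝ (Fin 3)) (D : ℝ), Real.sqrt Γ ≤ D →
              volume {τ : ℝ | ‖Ξ k τ - x‖ ≤ D} ≤ ENNReal.ofReal (C₀ * D)) →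
          (∀ j, ∃ τs : ℝ, w j τs = 0 ∧ (∀ τ, w j τ = 0 → τ = τs) ∧ 3 / 2 + δ ≤ deriv (w j) τs) →
          (∀ (k : Fin N) (τ : ℝ) (Y : EuclideanSpace ℝ (Fin 3)), Y = (Real.sqrt (Γ * Real.log Γ / 2))⁻¹ • Ξ k τ →
            R₁ ≤ ‖Y‖ → ‖Y‖ ≤ R₃ →
            ∀ (B b Bt : EuclideanSpace ℝ (Fin 3)) (c : ℝ), B = (1 / 2 : ℝ) • Y - α • cross (EuclideanSpace.single (2 : Fin 3) (1 : ℝ)) (Y) →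
              b = ‖B‖⁻¹ • B → Bt = (1 / 2 : ℝ) • deriv (Ξ k) τ - α • cross (EuclideanSpace.single (2 : Fin 3) (1 : ℝ)) (deriv (Ξ k) τ) → c = ⟪deriv (Ξ k) τ, b⟫ →
              ‖deriv (Ξ k) τ - c • b - (c / (4 * Real.pi / γ k) / ‖B‖ ^ 2) • cross b Bt‖ * ‖Y‖ ≤ ε) ∧
          (∀ (j : Fin N) (τs : ℝ), w j τs = 0 → ‖Ξ j τs‖ ≤ Real.sqrt (Γ * Real.log Γ / 2)) := by
  sorry

/-- **STUB 3 (`stub_rippleLipschitz`; size M; provable now).** The ripple functional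
`q_β(Y, T) = ‖T − c b − (c/β/‖B‖²) • b × Bt‖ · ‖Y‖` (`B = ½Y − α e₃×Y`, `b = B/‖B‖`, `Bt = ½T − α e₃×T`,
`c = ⟪T, b⟫`) is LIPSCHITZ in `(Y, T)` on the region `R₁/2 ≤ ‖Y‖ ≤ 2R₃`, `‖T‖ ≤ 1`, uniformly for
`βmin ≤ |β| ≤ βmax`: there `‖B‖ ≥ ‖Y‖/2 ≥ R₁/4 > 0` (the drift has no kernel: `‖½Y − αe₃×Y‖² = ¼‖Y‖² + α²‖Y_h‖²`),
so `q_β` is `C¹` with bounded gradient on a compact region any two of whose points are joined inside it by a path of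
length `≤ π ·` their distance. Why it might fail: only by a slip in constants. [folklore] -/
theorem stub_rippleLipschitz :
    ∀ (α βmin βmax R₁ R₃ : ℝ), 0 < βmin → βmin ≤ βmax → 0 < R₁ → R₁ ≤ R₃ →
      ∃ Cq : ℝ, 0 ≤ Cq ∧ ∀ β : ℝ, βmin ≤ |β| → |β| ≤ βmax →
        ∀ (Y T Y' T' : EuclideanSpace ℝ (Fin 3)), R₁ / 2 ≤ ‖Y‖ → ‖Y‖ ≤ 2 * R₃ → R₁ / 2 ≤ ‖Y'‖ → ‖Y'‖ ≤ 2 * R₃ →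
          ‖T‖ ≤ 1 → ‖T'‖ ≤ 1 →
          ∀ (B b Bt : EuclideanSpace ℝ (Fin 3)) (c : ℝ), B = (1 / 2 : ℝ) • Y - α • cross (EuclideanSpace.single (2 : Fin 3) (1 : ℝ)) (Y) →
            b = ‖B‖⁻¹ • B → Bt = (1 / 2 : ℝ) • T - α • cross (EuclideanSpace.single (2 : Fin 3) (1 : ℝ)) (T) → c = ⟪T, b⟫ →
          ∀ (B' b' Bt' : EuclideanSpace ℝ (Fin 3)) (c' : ℝ), B' = (1 / 2 : ℝ) • Y' - α • cross (EuclideanSpace.single (2 : Fin 3) (1 : ℝ)) (Y') →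
            b' = ‖B'‖⁻¹ • B' → Bt' = (1 / 2 : ℝ) • T' - α • cross (EuclideanSpace.single (2 : Fin 3) (1 : ℝ)) (T') → c' = ⟪T', b'⟫ →
          |‖T - c • b - (c / (β) / ‖B‖ ^ 2) • cross b Bt‖ * ‖Y‖ -
              ‖T' - c' • b' - (c' / (β) / ‖B'‖ ^ 2) • cross b' Bt'‖ * ‖Y'‖| ≤ Cq * (‖Y - Y'‖ + ‖T - T'‖) := by
  sorry

/-- **STUB 4 (`stub_mirrorPointSelection`; size L; THE NEW TYPED OBSTRUCTION — lens: negation).** For the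
outer ODE family `Yo″ = (4π/γ_k) • Yo′ × (½Yo − α e₃×Yo)` (`α ≠ 0`, finitely many nonzero `γ_k`) and every
tolerance `θ > 0` there are `ε₀ > 0` and shell radii `0 < R₁ ≤ R₃` such that every unit-speed `C²` solution whose
ripple functional (STUB 2/3, `β = 4π/γ_k`) is `≤ ε₀` at all of its points in the shell `R₁ ≤ ‖Yo‖ ≤ R₃` is
`θ`-VERTICAL (`‖Yo′ × e₃‖ ≤ θ`) at all of its points in the outer 2-ball. Content (census s2 §Negation; every
solution has slip `⟪A Yo, Yo′⟫′ = (γ_k/4π)/2…` — for `β = 1`: `V′ = ½` — hence ONE stagnation point and proper ends,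
so both ends of a solution entering the 2-ball cross the shell): (i) MIRROR-POINT LAW — at the stagnation point
`Yo′ ⊥ A Yo`, all of the unit speed is gyration, and the anti-mirror law `v⊥‖Y‖ ≈ const` makes the ripple of both
ends `≈ |Y₀|` (a far waist never even re-enters `‖Y‖ < |Y₀|`); (ii) NONDEGENERACY OF THE AXIS — linearising at the
axis `Yo = s e₃` gives the Weber equation `ζ″ + (is/2)ζ′ − (α + i/2)ζ = 0` (`u = e^{is²/8}ζ`:
`u″ + (s²/16 − α − 3i/4)u = 0`), branches `ζ ~ A s^{1−2iα}` (re-directed axis, log-spiral azimuth) and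
`ζ ~ B e^{−is²/4} s^{−2+2iα}` (ripple, `C₀ = |B|/2`); the ripple-free-at-`+∞` solution is
`U(2iα − 3/2, x e^{−iπ/4})`, `x = s/√2`, and the parabolic-cylinder connection formula gives it ripple `∝ 1/Γ(·) ≠ 0`
at `−∞` for every real `α ≠ 0` (degenerate exactly at `α = 0`, where all lines through the origin are solutions):
numerically the offset/tilt coefficients `|b_e|/2, |b_o|/2 = 1.58/1.41 (α = −1), 1.02/0.98 (α = −½), 36.6/32.7
(α = +1)` match the nonlinear `C₀/r₀, C₀/θ` to 3–4 digits, chirality ratio `e^{π|α|}`; (iii) GLOBAL — no other zero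
of the gyration map `(C₀⁺, C₀⁻)` on the 4-parameter family of waist data `(r₀, z₀, ψ, α)` (kit scan j024957,
grid 13×21×36×16 + origin launches + 264 Nelder–Mead refinements: 153 reach the axis zero, the other 111 stall at
ripple ≥ 0.61, none below; on the grid max(C₀⁺,C₀⁻) ≥ 0.43·dist(datum, axis datum); s1's F1 had covered origin launches only). A proof =
(ii) in closed form + (i) by first-order averaging + interval enclosure of the flow on the compact remainder.
Why it might fail: an isolated oblique zero of the gyration map missed by the grid (it would be a codimension-4
coincidence; the refinements from 200+ starts all fell into the axis zero or stalled at ripple ≥ O(1));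
`γ_k`-dependence enters only through the scaling `Y ↦ Y/√|β|`. [conjecture] -/
theorem stub_mirrorPointSelection :
    ∀ (N : ℕ) (γ : Fin N → ℝ) (α : ℝ), α ≠ 0 → (∀ k, γ k ≠ 0) →
      ∀ θ : ℝ, 0 < θ → ∃ ε₀ R₁ R₃ : ℝ, 0 < ε₀ ∧ 0 < R₁ ∧ R₁ ≤ R₃ ∧
        ∀ (k : Fin N) (Yo : ℝ → EuclideanSpace ℝ (Fin 3)), ContDiff ℝ 2 Yo → (∀ s, ‖deriv Yo s‖ = 1) →
          (∀ s, iteratedDeriv 2 Yo s =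
              (4 * Real.pi / γ k) • cross (deriv Yo s) ((1 / 2 : ℝ) • Yo s - α • cross (EuclideanSpace.single (2 : Fin 3) (1 : ℝ)) (Yo s))) →
          (∀ (s : ℝ), R₁ ≤ ‖Yo s‖ → ‖Yo s‖ ≤ R₃ →
            ∀ (B b Bt : EuclideanSpace ℝ (Fin 3)) (c : ℝ), B = (1 / 2 : ℝ) • Yo s - α • cross (EuclideanSpace.single (2 : Fin 3) (1 : ℝ)) (Yo s) →
              b = ‖B‖⁻¹ • B → Bt = (1 / 2 : ℝ) • deriv Yo s - α • cross (EuclideanSpace.single (2 : Fin 3) (1 : ℝ)) (deriv Yo s) → c = ⟪deriv Yo s, b⟫ →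
              ‖deriv Yo s - c • b - (c / (4 * Real.pi / γ k) / ‖B‖ ^ 2) • cross b Bt‖ * ‖Yo s‖ ≤ ε₀) →
          ∀ s, ‖Yo s‖ ≤ 2 → ‖cross (deriv Yo s) (EuclideanSpace.single (2 : Fin 3) (1 : ℝ))‖ ≤ θ := by
  sorry

/-- **STUB 5 (`stub_nearVerticalSubcritical`; size L; provable now in principle) — SHARED VERBATIM with s1's line
`kelvin-sonic-negation` (same name, same statement).** Near-vertical, length-regular relative equilibria are
SUBCRITICAL at their stagnation points: `w_j′(τ*) ≤ ½ + C(θ + 1/R)`. Proof sketch and sources: s1's docstring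
(landed strain identity `Theorems/SkeletonEquilibrium/Negative/StrainIdentity.lean`; `parallel_lines_drift`). [folklore] -/
theorem stub_nearVerticalSubcritical :
    ∀ (N : ℕ) (γ : Fin N → ℝ) (α ρ K C₀ : ℝ), 0 < ρ → 0 < C₀ → ∃ C : ℝ, 0 ≤ C ∧
      ∀ (θ R Γ : ℝ), 0 < θ → θ ≤ 1 → 1 ≤ R → 1 ≤ Γ →
        ∀ (Ξ : Fin N → ℝ → EuclideanSpace ℝ (Fin 3)) (w : Fin N → ℝ → ℝ),
          (∀ j, ContDiff ℝ 2 (Ξ j) ∧ Function.Injective (Ξ j) ∧ Differentiable ℝ (w j) ∧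
              (∀ τ, ‖deriv (Ξ j) τ‖ = 1) ∧ (∀ τ, ‖iteratedDeriv 2 (Ξ j) τ‖ * Real.sqrt Γ ≤ K) ∧
              Tendsto (fun τ => ‖Ξ j τ‖) atTop atTop ∧ Tendsto (fun τ => ‖Ξ j τ‖) atBot atTop) →
          (∀ j k, j ≠ k → ∀ τ σ, ρ * Real.sqrt Γ ≤ ‖Ξ j τ - Ξ k σ‖) →
          (∀ j (x : EuclideanSpace ℝ (Fin 3)), Integrable (fun σ : ℝ =>
              ((‖x - Ξ j σ‖ ^ 2 + 1) ^ (3 / 2 : ℝ))⁻¹ • cross (deriv (Ξ j) σ) (x - Ξ j σ))) →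
          (∀ j τ, (∑ k : Fin N, (Γ * γ k / (4 * Real.pi)) • ∫ σ : ℝ,
                ((‖Ξ j τ - Ξ k σ‖ ^ 2 + 1) ^ (3 / 2 : ℝ))⁻¹ • cross (deriv (Ξ k) σ) (Ξ j τ - Ξ k σ))
              + (1 / 2 : ℝ) • Ξ j τ - α • cross (EuclideanSpace.single (2 : Fin 3) (1 : ℝ)) (Ξ j τ)
              = w j τ • deriv (Ξ j) τ) →
          (∀ (k : Fin N) (x : EuclideanSpace ℝ (Fin 3)) (D : ℝ), Real.sqrt Γ ≤ D →
              volume {τ : ℝ | ‖Ξ k τ - x‖ ≤ D} ≤ ENNReal.ofReal (C₀ * D)) →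
          ∀ (j : Fin N) (τs : ℝ), w j τs = 0 →
            (∀ (k : Fin N) (τ : ℝ), ‖Ξ k τ - Ξ j τs‖ ≤ R * Real.sqrt Γ →
                ‖cross (deriv (Ξ k) τ) (EuclideanSpace.single (2 : Fin 3) (1 : ℝ))‖ ≤ θ) →
            deriv (w j) τs ≤ 1 / 2 + C * (θ + 1 / R) := by
  sorry

/-! ## Two elementary facts about the cross product used by the composition (sorry-free) -/

/-- `‖v × w‖ ≤ ‖v‖ ‖w‖` (from the Literature identity `norm_cross`). -/
theorem norm_cross_le (v w : EuclideanSpace ℝ (Fin 3)) : ‖cross v w‖ ≤ ‖v‖ * ‖w‖ := by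
  rw [norm_cross]
  have h1 : Real.sin (InnerProductGeometry.angle v w) ≤ 1 := Real.sin_le_one _
  have h2 : 0 ≤ ‖v‖ * ‖w‖ := by positivity
  nlinarith

/-- `(v − v′) × w = v × w − v′ × w` (bilinearity, via the bundled `crossCLM`). -/
theorem cross_sub_left (v v' w : EuclideanSpace ℝ (Fin 3)) : cross (v - v') w = cross v w - cross v' w := by
  rw [← crossCLM_apply, ← crossCLM_apply, ← crossCLM_apply]
  exact crossCLM.map_sub₂ v v' w

/-- `‖e₃‖ = 1`. -/
theorem norm_e3 : ‖(EuclideanSpace.single (2 : Fin 3) (1 : ℝ))‖ = 1 := by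
  simp

/-! ## Composition -/

/-- **The negation skeleton theorem (line `mirror-point-negation`)**: the six stubs compose to `¬ SkeletonEquilibrium`
(sorry-free). -/
theorem not_SkeletonEquilibrium_of :
    ¬ Theses.FilamentSkeletonRss.SkeletonEquilibrium := by
  intro h
  obtain ⟨N, γ, α, δ, ρ, K, hN, hα, hδ, hρ, hγ, hfam⟩ := h
  -- length-regularity constant of the data (STUB 0)
  obtain ⟨C₀, hC₀, hreg⟩ := stub_lengthRegular N γ α ρ K hα hρ
  -- subcriticality constant (STUB 5)
  obtain ⟨C, hC, hsub⟩ := stub_nearVerticalSubcritical N γ α ρ K C₀ hρ hC₀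
  -- tolerances
  set θ : ℝ := 1 / (4 * (C + 1)) with hθ_def
  set R : ℝ := 4 * (C + 1) with hR_def
  have hC1 : 0 < C + 1 := by linarith
  have hθ : 0 < θ := by rw [hθ_def]; positivity
  have hθ1 : θ ≤ 1 := by
    rw [hθ_def, div_le_one (by positivity)]; linarith
  have hR : 1 ≤ R := by rw [hR_def]; linarith
  have hR0 : 0 ≤ R := by linarith
  -- selection constants at tolerance θ/2 (STUB 4)
  obtain ⟨ε₀, R₁, R₃, hε₀, hR₁, hR₁₃, hsel⟩ :=
    stub_mirrorPointSelection N γ α hα hγ (θ / 2) (by positivity)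
  -- Lipschitz constant of the ripple functional on the doubled shell, for |β| = 4π/|γ k| (STUB 3)
  have hNpos : 0 < N := hN
  haveI : Nonempty (Fin N) := ⟨⟨0, hN⟩⟩
  -- bounds βmin ≤ |4π/γ k| ≤ βmax
  obtain ⟨βmin, βmax, hβmin, hβminmax, hβ⟩ :
      ∃ βmin βmax : ℝ, 0 < βmin ∧ βmin ≤ βmax ∧
        ∀ k : Fin N, βmin ≤ |4 * Real.pi / γ k| ∧ |4 * Real.pi / γ k| ≤ βmax := by
    classical
    let f : Fin N → ℝ := fun k => |4 * Real.pi / γ k|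
    have hfpos : ∀ k, 0 < f k := fun k => by
      show 0 < |4 * Real.pi / γ k|
      exact abs_pos.2 (div_ne_zero (mul_ne_zero (by norm_num) Real.pi_ne_zero) (hγ k))
    refine ⟨Finset.univ.inf' Finset.univ_nonempty f, Finset.univ.sup' Finset.univ_nonempty f, ?_, ?_, ?_⟩
    · obtain ⟨k, -, hk⟩ := Finset.exists_mem_eq_inf' Finset.univ_nonempty f
      rw [hk]; exact hfpos k
    · obtain ⟨k, -, hk⟩ := Finset.exists_mem_eq_inf' Finset.univ_nonempty f
      rw [hk]; exact Finset.le_sup' f (Finset.mem_univ k)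
    · intro k
      exact ⟨Finset.inf'_le f (Finset.mem_univ k), Finset.le_sup' f (Finset.mem_univ k)⟩
  obtain ⟨Cq, hCq, hlip⟩ := stub_rippleLipschitz α βmin βmax R₁ R₃ hβmin hβminmax hR₁ hR₁₃
  -- the working tolerance
  set ε : ℝ := min (min (θ / 2) (R₁ / 2)) (ε₀ / (2 * Cq + 2)) with hε_def
  have hε : 0 < ε := by
    rw [hε_def]
    refine lt_min (lt_min (by positivity) (by positivity)) (by positivity)
  have hεθ : ε ≤ θ / 2 := le_trans (min_le_left _ _) (min_le_left _ _)
  have hεR₁ : ε ≤ R₁ / 2 := le_trans (min_le_left _ _) (min_le_right _ _)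
  have hεε₀ : ε ≤ ε₀ / (2 * Cq + 2) := min_le_right _ _
  have hkey_eps : ε + Cq * (ε + ε) ≤ ε₀ := by
    have h1 : ε * (2 * Cq + 2) ≤ ε₀ := by
      have := (le_div_iff₀ (by positivity : (0:ℝ) < 2 * Cq + 2)).1 hεε₀
      linarith
    nlinarith
  -- thresholds (STUBS 1, 2)
  obtain ⟨Γ₁, hshadow⟩ :=
    stub_outerShadowing N γ α ρ K C₀ hα hρ hC₀ hγ ε hε R₁ R₃ R hR₁ hR₁₃ hR0
  obtain ⟨Γ₂, hripple⟩ :=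
    stub_rippleFree N γ α δ ρ K C₀ hα hδ hρ hC₀ hγ ε hε (R₁ / 2) (2 * R₃) (by positivity) (by linarith)
  -- evaluate the crux at Γ₀ = max (max Γ₁ Γ₂) 2
  obtain ⟨Γ, hΓ₀, hΓpos, Ξ, w, h1, h2, h3, h4, h5⟩ := hfam (max (max Γ₁ Γ₂) 2)
  have hΓ₁ : Γ₁ ≤ Γ := le_trans (le_trans (le_max_left _ _) (le_max_left _ _)) hΓ₀
  have hΓ₂ : Γ₂ ≤ Γ := le_trans (le_trans (le_max_right _ _) (le_max_left _ _)) hΓ₀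
  have hΓ2 : 2 ≤ Γ := le_trans (le_max_right _ _) hΓ₀
  have hΓ1 : 1 ≤ Γ := by linarith
  -- length regularity at this Γ
  have hL := hreg Γ hΓ1 Ξ w h1 h2 h3 h4
  -- ripple-free shell + waists inside the unit ball
  obtain ⟨hrip, hwaist⟩ := hripple Γ hΓ₂ hΓ1 Ξ w h1 h2 h3 h4 hL h5
  -- shadowing solutions
  have hsh := hshadow Γ hΓ₁ hΓ1 Ξ w h1 h2 h3 h4 hL
  -- a filament and its stagnation point
  set j : Fin N := ⟨0, hN⟩ with hj
  obtain ⟨τs, hz, huniq, hsc⟩ := h5 j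
  have hwj : ‖Ξ j τs‖ ≤ Real.sqrt (Γ * Real.log Γ / 2) := hwaist j τs hz
  -- VERTICALITY of every strand within R√Γ of the stagnation point
  have hvert : ∀ (k : Fin N) (τ : ℝ), ‖Ξ k τ - Ξ j τs‖ ≤ R * Real.sqrt Γ →
      ‖cross (deriv (Ξ k) τ) (EuclideanSpace.single (2 : Fin 3) (1 : ℝ))‖ ≤ θ := by
    intro k τ hkτ
    obtain ⟨Yo, hYo1, hYo2, hYo3, hYoa, hYob⟩ := hsh k
    -- the shadowing solution is ripple ≤ ε₀ on the shell
    have hYo_rip : ∀ (s : ℝ), R₁ ≤ ‖Yo s‖ → ‖Yo s‖ ≤ R₃ →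
        ∀ (B b Bt : EuclideanSpace ℝ (Fin 3)) (c : ℝ), B = (1 / 2 : ℝ) • Yo s - α • cross (EuclideanSpace.single (2 : Fin 3) (1 : ℝ)) (Yo s) →
          b = ‖B‖⁻¹ • B → Bt = (1 / 2 : ℝ) • deriv Yo s - α • cross (EuclideanSpace.single (2 : Fin 3) (1 : ℝ)) (deriv Yo s) → c = ⟪deriv Yo s, b⟫ →
          ‖deriv Yo s - c • b - (c / (4 * Real.pi / γ k) / ‖B‖ ^ 2) • cross b Bt‖ * ‖Yo s‖ ≤ ε₀ := by
      intro s hs1 hs3 B b Bt c hB hb hBt hc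
      obtain ⟨τ', hpos, htan⟩ := hYob s hs1 hs3
      set Y' : EuclideanSpace ℝ (Fin 3) := (Real.sqrt (Γ * Real.log Γ / 2))⁻¹ • Ξ k τ' with hY'_def
      -- the witness point is in the doubled shell
      have hnY' : ‖Y' - Yo s‖ ≤ ε := hpos
      have hY'lo : R₁ / 2 ≤ ‖Y'‖ := by
        have := norm_sub_norm_le (Yo s) Y'
        rw [norm_sub_rev] at this
        linarith
      have hY'hi : ‖Y'‖ ≤ 2 * R₃ := by
        have h' : ‖Y'‖ ≤ ‖Yo s‖ + ‖Y' - Yo s‖ := by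
          have := norm_add_le (Yo s) (Y' - Yo s)
          simpa using this
        linarith
      -- ripple of the witness there (STUB 2)
      set B' : EuclideanSpace ℝ (Fin 3) := (1 / 2 : ℝ) • Y' - α • cross (EuclideanSpace.single (2 : Fin 3) (1 : ℝ)) (Y') with hB'_def
      set b' : EuclideanSpace ℝ (Fin 3) := ‖B'‖⁻¹ • B' with hb'_def
      set Bt' : EuclideanSpace ℝ (Fin 3) := (1 / 2 : ℝ) • deriv (Ξ k) τ' - α • cross (EuclideanSpace.single (2 : Fin 3) (1 : ℝ)) (deriv (Ξ k) τ') with hBt'_def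
      set c' : ℝ := ⟪deriv (Ξ k) τ', b'⟫ with hc'_def
      have hripΞ := hrip k τ' Y' hY'_def hY'lo hY'hi B' b' Bt' c' hB'_def hb'_def hBt'_def hc'_def
      -- Lipschitz comparison (STUB 3)
      have hTYo : ‖deriv Yo s‖ ≤ 1 := le_of_eq (hYo2 s)
      have hTΞ : ‖deriv (Ξ k) τ'‖ ≤ 1 := le_of_eq ((h1 k).2.2.2.1 τ')
      have hYolo : R₁ / 2 ≤ ‖Yo s‖ := by linarith
      have hYohi : ‖Yo s‖ ≤ 2 * R₃ := by linarith
      have hβk := hβ k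
      have hL' := hlip (4 * Real.pi / γ k) hβk.1 hβk.2 (Yo s) (deriv Yo s) Y' (deriv (Ξ k) τ')
        hYolo hYohi hY'lo hY'hi hTYo hTΞ B b Bt c hB hb hBt hc B' b' Bt' c' hB'_def hb'_def hBt'_def hc'_def
      have hdist : ‖Yo s - Y'‖ + ‖deriv Yo s - deriv (Ξ k) τ'‖ ≤ ε + ε := by
        rw [norm_sub_rev (Yo s) Y', norm_sub_rev (deriv Yo s) (deriv (Ξ k) τ')]
        exact add_le_add hnY' htan
      have habs := abs_sub_le_iff.1 hL'
      have hmono : Cq * (‖Yo s - Y'‖ + ‖deriv Yo s - deriv (Ξ k) τ'‖) ≤ Cq * (ε + ε) :=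
        mul_le_mul_of_nonneg_left hdist hCq
      linarith [habs.1]
    -- hence θ/2-vertical on the outer 2-ball (STUB 4)
    have hYo_vert := hsel k Yo hYo1 hYo2 hYo3 hYo_rip
    -- the strand point lies in the inner ball ‖Ξ‖ ≤ ℓ + R√Γ
    have hin : ‖Ξ k τ‖ ≤ Real.sqrt (Γ * Real.log Γ / 2) + R * Real.sqrt Γ := by
      have h' : ‖Ξ k τ‖ ≤ ‖Ξ j τs‖ + ‖Ξ k τ - Ξ j τs‖ := by
        have := norm_add_le (Ξ j τs) (Ξ k τ - Ξ j τs)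
        simpa using this
      linarith
    obtain ⟨s, hs2, hts⟩ := hYoa τ hin
    have hv := hYo_vert s hs2
    -- transfer verticality from Yo′(s) to Ξ_k′(τ)
    calc ‖cross (deriv (Ξ k) τ) (EuclideanSpace.single (2 : Fin 3) (1 : ℝ))‖
        = ‖cross (deriv Yo s) (EuclideanSpace.single (2 : Fin 3) (1 : ℝ)) + cross (deriv (Ξ k) τ - deriv Yo s) (EuclideanSpace.single (2 : Fin 3) (1 : ℝ))‖ := by
          rw [cross_sub_left]; congr 1; abel
      _ ≤ ‖cross (deriv Yo s) (EuclideanSpace.single (2 : Fin 3) (1 : ℝ))‖ + ‖cross (deriv (Ξ k) τ - deriv Yo s) (EuclideanSpace.single (2 : Fin 3) (1 : ℝ))‖ := norm_add_le _ _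
      _ ≤ θ / 2 + ‖deriv (Ξ k) τ - deriv Yo s‖ * ‖(EuclideanSpace.single (2 : Fin 3) (1 : ℝ))‖ := add_le_add hv (norm_cross_le _ _)
      _ ≤ θ / 2 + ε := by rw [norm_e3, mul_one]; linarith
      _ ≤ θ := by linarith
  -- subcriticality (STUB 5)
  have hw := hsub θ R Γ hθ hθ1 hR hΓ1 Ξ w h1 h2 h3 h4 hL j τs hz hvert
  -- the chosen tolerances give C * (θ + 1/R) ≤ 1/2
  have hsum : θ + 1 / R = 1 / (2 * (C + 1)) := by
    rw [hθ_def, hR_def]; field_simp; ring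
  have hkey : C * (θ + 1 / R) ≤ 1 / 2 := by
    rw [hsum]
    rw [show C * (1 / (2 * (C + 1))) = C / (2 * (C + 1)) by ring]
    rw [div_le_iff₀ (by positivity)]
    linarith
  -- contradiction with (SC): 3/2 + δ ≤ w′(τ*) ≤ 1/2 + 1/2
  linarith

end Summit.NavierStokesRegularity.NavierStokesRegularity.Cruxes.SkeletonEquilibrium.MirrorPointNegation
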